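import Summits.PneNP.PneNP.Theorems.SzkEntropyPeaThreeNotInPCoreDefs

/-!
# Route SzkEntropy, crux `PeaThreeNotInP` (stmt-PneNP-10776), line `SketchIdeator3`, step S7:
# stub `stub_core` (three passes give a concise core and the rank triple)

Correctness of the THREE passes `coreN` of the concise-core algorithm, from one-pass correctness
(hypothesis `hpass`, the neighbour stub `stub_pass`) and the existence of left inverses of
full-column-rank matrices over `F₂` (hypothesis `hleft`, third conjunct of the neighbour stub
`stub_linalg`): the output support tensor `X = ofSupportN r₁ r₂ r₃ L₃` of `coreN L` is a concise
core of `T = ofSupportN a b c L` (`IsCoreOf T X`), and the output formats `(r₁, r₂, r₃)` are the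
three flattening ranks of `T`.

Proof (matrix algebra on the first flattening).  Rectangular multilinear multiplications compose
by the Kronecker mixed-product rule, `tmul P Q R (tmul P' Q' R' X) = tmul (P P') (Q Q') (R R') X`;
the cyclic rotation permutes the three factors, `rotT (tmul P Q R X) = tmul Q R P (rotT X)`;
`rotT³ = id`, `rotT² = flat₃`, and `rotT` is a column permutation of `flat₂`.  Chaining the three
passes `T = tmul P 1 1 (rotT² W₁)`, `W₁ = tmul Q 1 1 (rotT² W₂)`, `W₂ = tmul R 1 1 (rotT² X)` gives
`rotT² W₂ = tmul 1 R 1 (rotT X)`, `rotT² W₁ = tmul 1 Q R X` and `T = tmul P Q R X`.  A left factor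
with a left inverse and a right factor `(Q ⊗ R)ᵀ` with `Q`, `R` left-invertible preserve the rank
(`(Q' ⊗ R')(Q ⊗ R) = Q'Q ⊗ R'R = 1`), whence `rank (tmul P Q R X) = rank X` and the six rank
identities.  Sources: J. A. Grochow, Y. Qiao, *On the complexity of isomorphism problems for
tensors, groups, and polynomials I*, SIAM J. Comput. 52 (2023), §2 (flattenings, nondegenerate
tensors, multilinear multiplication); the lead notes `Cruxes/PeaThreeNotInP/NOTES.md`, step S7.
-/

noncomputable section

open Matrix
open scoped Kronecker
open _root_.Computability
open Literature.Computability.Complexity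

namespace Summit.PneNP.PneNP.Cruxes.PeaThreeNotInP.TensorIsoLine

set_option linter.dupNamespace false -- `Summit.PneNP.PneNP.…`: summit = sub-problem name (D-0017 single-conjunct layout)

variable {a b c a' b' c' a'' b'' c'' : ℕ}

/-! ### Algebra of rectangular multilinear multiplication and of the cyclic rotation -/

/-- Composition of rectangular multilinear multiplications (Kronecker mixed-product rule):
`tmul P Q R (tmul P' Q' R' X) = tmul (P P') (Q Q') (R R') X`. [GrochowQiao2023, §2] -/
theorem core_tmul_tmul (P : Matrix (Fin a) (Fin a') (ZMod 2)) (Q : Matrix (Fin b) (Fin b') (ZMod 2))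
    (R : Matrix (Fin c) (Fin c') (ZMod 2)) (P' : Matrix (Fin a') (Fin a'') (ZMod 2))
    (Q' : Matrix (Fin b') (Fin b'') (ZMod 2)) (R' : Matrix (Fin c') (Fin c'') (ZMod 2))
    (X : Tensor3 a'' b'' c'') :
    tmul P Q R (tmul P' Q' R' X) = tmul (P * P') (Q * Q') (R * R') X := by
  simp only [tmul, Matrix.mul_kronecker_mul, Matrix.transpose_mul, Matrix.mul_assoc]

/-- The cyclic rotation permutes the three factors of a multilinear multiplication:
`rotT (tmul P Q R X) = tmul Q R P (rotT X)`. [GrochowQiao2023, §2] -/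
theorem core_rotT_tmul (P : Matrix (Fin a) (Fin a') (ZMod 2)) (Q : Matrix (Fin b) (Fin b') (ZMod 2))
    (R : Matrix (Fin c) (Fin c') (ZMod 2)) (X : Tensor3 a' b' c') :
    rotT (tmul P Q R X) = tmul Q R P (rotT X) := by
  ext j ⟨k, i⟩
  simp only [rotT, tmul, of_apply, mul_apply, transpose_apply, kroneckerMap_apply,
    Finset.sum_mul, Fintype.sum_prod_type]
  rw [Finset.sum_comm]
  refine Finset.sum_congr rfl fun k' _ => ?_
  rw [Finset.sum_comm]
  refine Finset.sum_congr rfl fun i' _ => Finset.sum_congr rfl fun j' _ => ?_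
  ring

/-- Two rotations of a multilinear multiplication:
`rotT (rotT (tmul P Q R X)) = tmul R P Q (rotT (rotT X))`. [GrochowQiao2023, §2] -/
theorem core_rotT_rotT_tmul (P : Matrix (Fin a) (Fin a') (ZMod 2))
    (Q : Matrix (Fin b) (Fin b') (ZMod 2)) (R : Matrix (Fin c) (Fin c') (ZMod 2))
    (X : Tensor3 a' b' c') :
    rotT (rotT (tmul P Q R X)) = tmul R P Q (rotT (rotT X)) := by
  rw [core_rotT_tmul, core_rotT_tmul]

/-- Two rotations are the third flattening: `rotT (rotT X) = flat₃ X`. [folklore] -/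
theorem core_rotT_rotT (X : Tensor3 a b c) : rotT (rotT X) = flat₃ X := by
  ext k ⟨i, j⟩
  rfl

/-- One rotation is a column permutation of the second flattening. [folklore] -/
theorem core_rotT_eq_submatrix (X : Tensor3 a b c) :
    rotT X = (flat₂ X).submatrix (Equiv.refl (Fin b)) (Equiv.prodComm (Fin c) (Fin a)) := by
  ext j ⟨k, i⟩
  rfl

/-- The rank of one rotation is the rank of the second flattening. [folklore] -/
theorem core_rank_rotT (X : Tensor3 a b c) : (rotT X).rank = (flat₂ X).rank := by
  rw [core_rotT_eq_submatrix, Matrix.rank_submatrix]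

/-! ### Ranks under one-sided inverses -/

/-- A left factor with a left inverse preserves the rank. [folklore] -/
theorem core_rank_mul_left {m n ι : Type*} [Fintype m] [Fintype n] [Fintype ι] [DecidableEq n]
    {P : Matrix m n (ZMod 2)} {P' : Matrix n m (ZMod 2)} (h : P' * P = 1)
    (M : Matrix n ι (ZMod 2)) : (P * M).rank = M.rank := by
  refine le_antisymm (Matrix.rank_mul_le_right _ _) ?_
  calc M.rank = (P' * (P * M)).rank := by rw [← Matrix.mul_assoc, h, Matrix.one_mul]
    _ ≤ (P * M).rank := Matrix.rank_mul_le_right _ _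

/-- A right factor `Nᵀ` with `N` left-invertible preserves the rank. [folklore] -/
theorem core_rank_mul_transpose {m n ι : Type*} [Fintype m] [Fintype n] [DecidableEq n]
    (M : Matrix ι n (ZMod 2)) {N : Matrix m n (ZMod 2)} {N' : Matrix n m (ZMod 2)}
    (h : N' * N = 1) : (M * Nᵀ).rank = M.rank := by
  refine le_antisymm (Matrix.rank_mul_le_left _ _) ?_
  calc M.rank = (M * Nᵀ * N'ᵀ).rank := by
        rw [Matrix.mul_assoc, ← Matrix.transpose_mul, h, Matrix.transpose_one, Matrix.mul_one]
    _ ≤ (M * Nᵀ).rank := Matrix.rank_mul_le_left _ _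

/-- Kronecker products of left inverses are left inverses:
`(Q' ⊗ R') (Q ⊗ R) = Q'Q ⊗ R'R = 1`. [folklore] -/
theorem core_kronecker_leftInv {Q : Matrix (Fin b) (Fin b') (ZMod 2)}
    {Q' : Matrix (Fin b') (Fin b) (ZMod 2)} {R : Matrix (Fin c) (Fin c') (ZMod 2)}
    {R' : Matrix (Fin c') (Fin c) (ZMod 2)} (hQ : Q' * Q = 1) (hR : R' * R = 1) :
    (Q' ⊗ₖ R') * (Q ⊗ₖ R) = 1 := by
  rw [← Matrix.mul_kronecker_mul, hQ, hR, Matrix.one_kronecker_one]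

/-- The identity matrix is its own left inverse. [folklore] -/
theorem core_one_leftInv (n : ℕ) :
    (1 : Matrix (Fin n) (Fin n) (ZMod 2)) * (1 : Matrix (Fin n) (Fin n) (ZMod 2)) = 1 :=
  Matrix.one_mul _

/-- Multilinear multiplication by left-invertible matrices preserves the rank of the first
flattening: `rank (tmul P Q R X) = rank X`. [GrochowQiao2023, §2] -/
theorem core_rank_tmul {P : Matrix (Fin a) (Fin a') (ZMod 2)} {Q : Matrix (Fin b) (Fin b') (ZMod 2)}
    {R : Matrix (Fin c) (Fin c') (ZMod 2)} {P' : Matrix (Fin a') (Fin a) (ZMod 2)}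
    {Q' : Matrix (Fin b') (Fin b) (ZMod 2)} {R' : Matrix (Fin c') (Fin c) (ZMod 2)}
    (hP : P' * P = 1) (hQ : Q' * Q = 1) (hR : R' * R = 1) (X : Tensor3 a' b' c') :
    (tmul P Q R X).rank = X.rank := by
  rw [tmul, Matrix.mul_assoc, core_rank_mul_left hP,
    core_rank_mul_transpose X (core_kronecker_leftInv hQ hR)]

/-! ### Three passes -/

/-- Chaining three rotated one-direction reductions: from `W₂ = tmul R 1 1 (rotT² X)`,
`W₁ = tmul Q 1 1 (rotT² W₂)` and `T = tmul P 1 1 (rotT² W₁)` one gets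
`rotT² W₂ = tmul 1 R 1 (rotT X)`, `rotT² W₁ = tmul 1 Q R X` and `T = tmul P Q R X`
(composition of `tmul`, rotation of the factors, `rotT³ = id`). [GrochowQiao2023, §2] -/
theorem core_chain {r₁ r₂ r₃ : ℕ} (X : Tensor3 r₁ r₂ r₃) (P : Matrix (Fin a) (Fin r₁) (ZMod 2))
    (Q : Matrix (Fin b) (Fin r₂) (ZMod 2)) (R : Matrix (Fin c) (Fin r₃) (ZMod 2))
    {W₂ : Tensor3 c r₁ r₂} {W₁ : Tensor3 b c r₁} {T : Tensor3 a b c}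
    (hW₂ : W₂ = tmul R 1 1 (rotT (rotT X))) (hW₁ : W₁ = tmul Q 1 1 (rotT (rotT W₂)))
    (hT : T = tmul P 1 1 (rotT (rotT W₁))) :
    rotT (rotT W₂) = tmul 1 R 1 (rotT X) ∧ rotT (rotT W₁) = tmul 1 Q R X ∧ T = tmul P Q R X := by
  have h₂ : rotT (rotT W₂) = tmul 1 R 1 (rotT X) := by
    rw [hW₂, core_rotT_rotT_tmul, stub_rotT_three]
  have h₁ : rotT (rotT W₁) = tmul 1 Q R X := by
    rw [hW₁, h₂, core_tmul_tmul, core_rotT_rotT_tmul, stub_rotT_three]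
    simp only [Matrix.mul_one, Matrix.one_mul]
  refine ⟨h₂, h₁, ?_⟩
  rw [hT, h₁, core_tmul_tmul]
  simp only [Matrix.mul_one, Matrix.one_mul]

/-- Assembly with free formats: under left inverses of `P, Q, R` and the three rank hypotheses of
the passes, `X` is concise, `T = tmul P Q R X`, and `(r₁, r₂, r₃)` are the flattening ranks of `T`.
[GrochowQiao2023, §2] -/
theorem core_assembly {r₁ r₂ r₃ : ℕ} {X : Tensor3 r₁ r₂ r₃} {P : Matrix (Fin a) (Fin r₁) (ZMod 2)}
    {Q : Matrix (Fin b) (Fin r₂) (ZMod 2)} {R : Matrix (Fin c) (Fin r₃) (ZMod 2)}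
    {P' : Matrix (Fin r₁) (Fin a) (ZMod 2)} {Q' : Matrix (Fin r₂) (Fin b) (ZMod 2)}
    {R' : Matrix (Fin r₃) (Fin c) (ZMod 2)} (hP' : P' * P = 1) (hQ' : Q' * Q = 1)
    (hR' : R' * R = 1) {W₂ : Tensor3 c r₁ r₂} {W₁ : Tensor3 b c r₁} {T : Tensor3 a b c}
    (hW₂ : W₂ = tmul R 1 1 (rotT (rotT X))) (hW₁ : W₁ = tmul Q 1 1 (rotT (rotT W₂)))
    (hT : T = tmul P 1 1 (rotT (rotT W₁))) (hrk₁ : (rotT (rotT W₁)).rank = r₁)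
    (hrk₂ : (rotT (rotT W₂)).rank = r₂) (hrk₃ : (rotT (rotT X)).rank = r₃) :
    (Concise X ∧ T = tmul P Q R X) ∧ (r₁, r₂, r₃) = (T.rank, (flat₂ T).rank, (flat₃ T).rank) := by
  obtain ⟨h₂, h₁, hT'⟩ := core_chain X P Q R hW₂ hW₁ hT
  rw [h₁, core_rank_tmul (core_one_leftInv _) hQ' hR'] at hrk₁
  rw [h₂, core_rank_tmul (core_one_leftInv _) hR' (core_one_leftInv _), core_rank_rotT] at hrk₂
  have hT₁ : T.rank = r₁ := by rw [hT', core_rank_tmul hP' hQ' hR', hrk₁]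
  have hT₂ : (flat₂ T).rank = r₂ := by
    rw [← core_rank_rotT, hT', core_rotT_tmul, core_rank_tmul hQ' hR' hP', core_rank_rotT, hrk₂]
  have hT₃ : (flat₃ T).rank = r₃ := by
    rw [← core_rotT_rotT, hT', core_rotT_rotT_tmul, core_rank_tmul hR' hP' hQ', hrk₃]
  rw [core_rotT_rotT] at hrk₃
  exact ⟨⟨⟨hrk₁, hrk₂, hrk₃⟩, hT'⟩, by rw [hT₁, hT₂, hT₃]⟩

/-! ### The stub -/

/-- **stub (W5)**: correctness of the three passes, from one-pass correctness and left inverses —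
the output is a concise core (`tmul`-composition under `rotT`, `rotT³ = id`, `rotT² = flat₃`, ranks
under left-invertible factors) and the output formats are the three flattening ranks of the input.
[GrochowQiao2023, §2] -/
theorem stub_core
    (hpass : ∀ (a b c : ℕ) (L : List (ℕ × ℕ × ℕ)),
      (∀ p ∈ L, p.1 < a ∧ p.2.1 < b ∧ p.2.2 < c) →
      (∀ p ∈ (passN L).2, p.1 < b ∧ p.2.1 < c ∧ p.2.2 < (passN L).1) ∧
      (rotT (rotT (ofSupportN b c (passN L).1 (passN L).2))).rank = (passN L).1 ∧
      ∃ P : Matrix (Fin a) (Fin (passN L).1) (ZMod 2), P.rank = (passN L).1 ∧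
        ofSupportN a b c L = tmul P 1 1 (rotT (rotT (ofSupportN b c (passN L).1 (passN L).2))))
    (hleft : ∀ {a r : ℕ} (P : Matrix (Fin a) (Fin r) (ZMod 2)), P.rank = r →
      ∃ P' : Matrix (Fin r) (Fin a) (ZMod 2), P' * P = 1)
    (a b c : ℕ) (L : List (ℕ × ℕ × ℕ)) (hL : ∀ p ∈ L, p.1 < a ∧ p.2.1 < b ∧ p.2.2 < c) :
    IsCoreOf (ofSupportN a b c L)
        (ofSupportN (coreN L).1.1 (coreN L).1.2.1 (coreN L).1.2.2 (coreN L).2) ∧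
      (coreN L).1 = ((ofSupportN a b c L).rank, (flat₂ (ofSupportN a b c L)).rank,
        (flat₃ (ofSupportN a b c L)).rank) := by
  obtain ⟨hL₁, hrk₁, P, hP, hT⟩ := hpass a b c L hL
  obtain ⟨hL₂, hrk₂, Q, hQ, hW₁⟩ := hpass b c _ _ hL₁
  obtain ⟨-, hrk₃, R, hR, hW₂⟩ := hpass c _ _ _ hL₂
  obtain ⟨P', hP'⟩ := hleft P hP
  obtain ⟨Q', hQ'⟩ := hleft Q hQ
  obtain ⟨R', hR'⟩ := hleft R hR
  obtain ⟨⟨hX, hT'⟩, hr⟩ := core_assembly hP' hQ' hR' hW₂ hW₁ hT hrk₁ hrk₂ hrk₃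
  dsimp only [coreN]
  exact ⟨⟨hX, P, Q, R, hP, hQ, hR, hT'⟩, hr⟩

end Summit.PneNP.PneNP.Cruxes.PeaThreeNotInP.TensorIsoLine

end
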